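import Mathlib
import Literature.RingTheory.CohomologyAnnihilator.Localization
import Literature.RingTheory.CohomologyAnnihilator.SyzygyBaseChange
import Literature.RingTheory.CohomologyAnnihilator.SyzygyDescent
import Literature.RingTheory.CohomologyAnnihilator.TowerRestrict
import Literature.RingTheory.CohomologyAnnihilator.TowerSyzygy
import Summits.ResolutionOfSingularities.ResolutionOfSingularities.Theorems.HomologicalConductorPersistenceSurfaceCompleteHerzogTransfer
import HarnessLib

/-!
# Rung S-2 `PersistenceSurface` (stmt-ResolutionOfSingularities-19970), stub C1 (`Sat₄`) — «LOCAL HERZOG FROM GLOBAL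
# HERZOG» for an ARBITRARY localisation `S` of `R` (`[IsLocalization P S]`), with `R ∈ add V` DERIVED

[OURS · cell decomp-res · rung S-2; seat leafhand-res-homologicalconduct-17 gen 0]  Nothing here is a statement of the
manuscript under review (Hironaka 2017); AI-written, weaker than expert review.  DEF-FREE.

Item (F1) of the repair census of hand 15 (HAND15-TRANSPORT §3 / gen-end report): the landed
`…PersistenceSurfaceLocalHerzogTransfer.isRetractOfPower_of_isSyzygy_two_localization` is stated for Mathlib's
`Localization P`; the capstone of the level-exact completion transport of the toric `Sat₄` theorem wants it for the
abstract localisation `S` of `U = k[u,v]^{(n;1,q)}` at the vertex (`[IsLocalization.AtPrime S 𝔪]`, the binder style of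
`…CommonCompletion` / `…VertexDimension`), where specialising to `Localization.AtPrime 𝔪` hits an instance-path
timeout.  This file re-runs the transfer for any `[IsLocalization P S]` and removes the hypothesis `R ∈ add V` (it
follows from the Herzog cover itself: `R` is a second syzygy of `0`).

* `isLocalizedModule_subtype_of_span_eq_top_of_isLocalization`, `exists_iso_baseChange_of_isLocalization` — a
  finitely generated `S`-module is `S ⊗_R M` for a finitely generated `R`-module `M` (the `R`-span of generators);
* `isSyzygy_two_punit_self` — `R` is a second syzygy module of `0`;
* `isRetractOfPower_of_isSyzygy_two_of_isLocalization` — THE TRANSFER: if every second syzygy module over the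
  noetherian `R` lies in `add V`, every second syzygy module over `S` lies in `add (S ⊗_R V)`.

References: S. B. Iyengar, R. Takahashi, IMRN 2016, Def. 4.1, Lemma 2.10 [`IyengarTakahashi2014`]; H. Matsumura,
*Commutative Ring Theory*, §19 Lemma 3 (Schanuel) [`Matsumura1987`] — tree lemmas only.
-/

-- single-problem summit: the doubled namespace component `ResolutionOfSingularities` is forced
set_option linter.dupNamespace false

noncomputable section

open CategoryTheory TensorProduct Literature.RingTheory.CohomologyAnnihilator
open Summit.ResolutionOfSingularities.ResolutionOfSingularities.Theorems.HomologicalConductor.PersistenceSurfaceCompleteHerzogTransfer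
  (isRetractOfPower_baseChange)

universe u

namespace Summit.ResolutionOfSingularities.ResolutionOfSingularities.Theorems.HomologicalConductor.PersistenceSurfaceLocalHerzogIsLocalization

variable {R : Type u} [CommRing R]

/-! ## Finitely generated `S`-modules come from finitely generated `R`-modules -/

/-- An `R`-submodule `M₀` of an `S`-module `N` (`S` a localisation of `R` at `P`) which generates `N` over `S`
exhibits `N` as the localisation `P⁻¹M₀` via the inclusion (the tree's `isLocalizedModule_subtype_of_span_eq_top`
for an arbitrary `[IsLocalization P S]`). [folklore] -/
theorem isLocalizedModule_subtype_of_span_eq_top_of_isLocalization (P : Submonoid R) (S : Type u) [CommRing S]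
    [Algebra R S] [IsLocalization P S] {N : Type u} [AddCommGroup N] [Module R N] [Module S N] [IsScalarTower R S N]
    (M₀ : Submodule R N) (h : Submodule.span S (M₀ : Set N) = ⊤) :
    IsLocalizedModule P M₀.subtype where
  map_units u := (isLocalizedModule_id P N S).map_units u
  surj y := by
    obtain ⟨t, ht⟩ := multiple_mem_span_of_mem_localization_span P S (M₀ : Set N) y
      (by rw [h]; exact Submodule.mem_top)
    rw [Submodule.span_eq] at ht
    exact ⟨⟨⟨t • y, ht⟩, t⟩, rfl⟩
  exists_of_eq h := ⟨1, by simpa using Subtype.ext h⟩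

/-- **Every finitely generated `S`-module is a base change `S ⊗_R M` of a finitely generated `R`-module** (`S` a
localisation of `R`; `M` = the `R`-span of a finite `S`-generating set). [cite: IyengarTakahashi2014, Lemma 2.10 (proof)] -/
theorem exists_iso_baseChange_of_isLocalization (P : Submonoid R) (S : Type u) [CommRing S] [Algebra R S]
    [IsLocalization P S] (N : Type u) [AddCommGroup N] [Module R N] [Module S N] [IsScalarTower R S N]
    [Module.Finite S N] :
    ∃ M : ModuleCat.{u} R, Module.Finite R M ∧ Nonempty (ModuleCat.of S (S ⊗[R] M) ≅ ModuleCat.of S N) := by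
  classical
  obtain ⟨s, hs⟩ := Module.Finite.fg_top (R := S) (M := N)
  let M₀ : Submodule R N := Submodule.span R (s : Set N)
  have hM₀ : Module.Finite R M₀ := Module.Finite.iff_fg.mpr (Submodule.fg_span s.finite_toSet)
  haveI : IsLocalizedModule P M₀.subtype :=
    isLocalizedModule_subtype_of_span_eq_top_of_isLocalization P S M₀ (by
      rw [← hs]; exact Submodule.span_span_of_tower R S (s : Set N))
  exact ⟨ModuleCat.of R M₀, hM₀, ⟨(IsLocalizedModule.isBaseChange P S M₀.subtype).equiv.toModuleIso⟩⟩

/-! ## `R` is a second syzygy of `0` -/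

/-- **`R = Ω²(0)`**: `0 → R → R → 0 → 0` and `0 → 0 → 0 → 0 → 0` are syzygy sequences, so the free module `R` is a
second syzygy module of the zero module. [folklore] -/
theorem isSyzygy_two_punit_self (S : Type u) [CommRing S] :
    IsSyzygy 2 (ModuleCat.of S PUnit.{u + 1}) (ModuleCat.of S S) := by
  refine isSyzygy_succ_iff_exists_first.mpr
    ⟨ModuleCat.of S PUnit.{u + 1}, isSyzygy_one_projective inferInstance projective_punit, ?_⟩
  rw [isSyzygy_one_iff]
  obtain ⟨w, hS⟩ := exists_shortExact_of_linearMap (Y := ModuleCat.of S S) (M := ModuleCat.of S S)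
    (X := ModuleCat.of S PUnit.{u + 1}) LinearMap.id 0 Function.injective_id
    (fun y => ⟨0, Subsingleton.elim _ _⟩)
    (fun y => ⟨fun _ => ⟨y, rfl⟩, fun _ => Subsingleton.elim _ _⟩)
  exact ⟨ModuleCat.of S S, inferInstance, inferInstance, _, _, w, hS⟩

/-! ## The transfer -/

/-- **LOCAL HERZOG FROM GLOBAL HERZOG, for any localisation.**  `R` noetherian, `P ⊆ R` multiplicative, `S` a
localisation of `R` at `P`, `V` an `R`-module; if every second syzygy module (of a finitely generated module) over `R`
is a retract of a power of `V`, then every second syzygy module over `S` is a retract of a power of `S ⊗_R V`.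
Mechanism as in `…LocalHerzogTransfer`: `M' ≅ S ⊗ M` (`M` finitely generated over `R`), a second syzygy `K` of `M`
base-changes to one of `M'` (`S` flat), Schanuel makes `K'` a retract of `(S ⊗ K) ⊕ P₁`, and `S ⊗ K`, `S = S ⊗ R`,
`P₁` lie in `add (S ⊗ V)` (`R ∈ add V` by `isSyzygy_two_punit_self`). [OURS · cell decomp-res] -/
theorem isRetractOfPower_of_isSyzygy_two_of_isLocalization [IsNoetherianRing R] (P : Submonoid R) (S : Type u)
    [CommRing S] [Algebra R S] [IsLocalization P S] (V : ModuleCat.{u} R)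
    (hHerzog : ∀ (M K : ModuleCat.{u} R), Module.Finite R M → IsSyzygy 2 M K → IsRetractOfPower V K)
    (M' K' : ModuleCat.{u} S) [Module.Finite S M'] (hK' : IsSyzygy 2 M' K') :
    IsRetractOfPower (ModuleCat.of S (S ⊗[R] V)) K' := by
  -- `M' ≅ S ⊗ M` with `M` finitely generated over `R`
  letI : Module R M' := Module.compHom M' (algebraMap R S)
  haveI : IsScalarTower R S M' := IsScalarTower.of_algebraMap_smul fun _ _ => rfl
  obtain ⟨M, hM, ⟨e⟩⟩ := exists_iso_baseChange_of_isLocalization P S M'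
  haveI := hM
  -- a second syzygy `K` of `M` over `R`
  obtain ⟨K₁, hK₁⟩ := exists_isSyzygy_one M
  haveI : Module.Finite R K₁ := finite_of_isSyzygy 1 hM hK₁
  obtain ⟨K, hK⟩ := exists_isSyzygy_one K₁
  have hK2 : IsSyzygy 2 M K := isSyzygy_succ_iff_exists_first.mpr ⟨K₁, hK₁, hK⟩
  -- base change to `S` (flat) and transport along `e`
  haveI : Module.Flat R S := IsLocalization.flat S P
  have hKL : IsSyzygy 2 M' (ModuleCat.of S (S ⊗[R] K)) := (IsSyzygy.baseChange S 2 hK2).of_iso_base e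
  -- Schanuel: `K' ⊕ P₂ ≅ (S ⊗ K) ⊕ P₁`
  obtain ⟨P₁, P₂, hP₁, hproj₁, hP₂, hproj₂, ⟨ι⟩⟩ := IsSyzygy.exists_stablyIso hK' hKL
  -- the generator `S ⊗ V` covers `S ⊗ K`, `S`, and `P₁`
  have hLK : IsRetractOfPower (ModuleCat.of S (S ⊗[R] V)) (ModuleCat.of S (S ⊗[R] K)) :=
    isRetractOfPower_baseChange S (hHerzog M K hM hK2)
  have hR : IsRetractOfPower V (ModuleCat.of R R) :=
    hHerzog _ _ (inferInstance : Module.Finite R PUnit.{u + 1}) (isSyzygy_two_punit_self R)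
  have hL : IsRetractOfPower (ModuleCat.of S (S ⊗[R] V)) (ModuleCat.of S S) :=
    (isRetractOfPower_baseChange S hR).of_iso (AlgebraTensorModule.rid R S S).toModuleIso
  have hP₁' : IsRetractOfPower (ModuleCat.of S (S ⊗[R] V)) P₁ := IsRetractOfPower.of_projective hL hP₁ hproj₁
  have hsum := (hLK.prod hP₁').of_iso ι.symm
  exact hsum.of_retract (ModuleCat.ofHom (LinearMap.inl S K' P₂)) (ModuleCat.ofHom (LinearMap.fst S K' P₂))
    (by apply ModuleCat.hom_ext; exact LinearMap.ext fun _ => rfl)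

end Summit.ResolutionOfSingularities.ResolutionOfSingularities.Theorems.HomologicalConductor.PersistenceSurfaceLocalHerzogIsLocalization

end
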